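import Mathlib
import HarnessLib
import Summits.HubbardSuperconductivity.HubbardSuperconductivity.Theorems.KLProgrammeKLRegimeSplitFrameExtFnBounds
import Summits.HubbardSuperconductivity.HubbardSuperconductivity.Theorems.KLProgrammeKLRegimeSplitFrameFnLemmas

/-!
# Route `KLProgramme`, crux K3 — Δ23 / (R-I): the de-interpolated G-extension `klFrameExtFn μ f` IS A SYMMETRIC FRAME (from the
# `D₄`-symmetries of the profile), is as SMOOTH as the profile on `klWindowC`, and obeys the EXPLICIT all-order derivative bounds

Cell gate-hubbard-kl, seat hubbard-kl-k3c3-p1 (g2; row «δμ-flow with `klAngularMean` constant piece»).  p2 g6's (R-I) core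
(`…SplitFrameFn` p479563, `…SplitFrameFnLemmas`) defines the carrier `FrameFn`, `IsSymmetricFrame`, `centredRep`, `klFlatCutoffFn` and
`klFrameExtFn μ f = p ↦ mean f + χ_flat(p)·(f(θ(p̃)) − mean f)` and leaves «the `D₄`-symmetry / smoothness of `klFrameExtFn μ f` (under the
symmetries and regularity of `f`)» to this seat (FrameFnLemmas docstring).  Here they are, together with the sizes:

* §1 `polarAngle_eq_add_int_mul` (the polar angle is determined mod `2π` by `r cos φ = k₀`, `r sin φ = k₁`; via `exp(iθ)` and
  `Complex.exp_eq_exp_iff_exists_int`), `apply_polarAngle_reflect` (`f(θ(k₀,−k₁)) = f(θ(k))` for even `2π`-periodic `f`),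
  `apply_polarAngle_swap` (`f(θ(k₁,k₀)) = f(θ(k))` when `f(π/2 − θ) = f(θ)`);
* §2 centring under the symmetries: `toIocMod_neg_eq_neg_of_ne_pi` / `toIocMod_neg_eq_of_eq_pi` (negation vs the cell boundary),
  `centredRep_swap`, `centredRep_add_int_mul`, `freeBandFn_symm`;
* §3 **`isSymmetricFrame_klFrameExtFn`**: for `f` `2π`-periodic, even and invariant under `θ ↦ π/2 − θ` (the symmetries k3c3-p3 proved
  for `klLocalPart`), and `μ ≥ −39/10` (the cutoff then kills the centre of the zone, where the angle is undefined),
  `IsSymmetricFrame (klFrameExtFn μ f)` — periodicity for free, reflection with the cell-boundary case `p̃₁ = π` handled separately, swap;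
* §4 `onM_klFrameExtFn_eq` (the `Momentum` reading is the lambda of `…SplitFrameExtFnBounds`), **`norm_iteratedFDeriv_onM_klFrameExtFn_le`**:
  `‖Dⁿ (onM (klFrameExtFn μ f)) q‖ ≤ [n=0]·|mean f| + (n!)²·(2·n!·X·200ⁿ)·G·(4 + max 1 (5(n−1)!/8))ⁿ` at every `q`, for `μ ∈ klWindowC`,
  `‖Dⁱ(f − mean f)‖ ≤ G` (`i ≤ n`), `‖Dˡχ₂‖ ≤ X` (`l ≤ n`); and **`contDiff_onM_klFrameExtFn`**: `ContDiff ℝ N (onM (klFrameExtFn μ f))` for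
  `f ∈ C^N` (`N : ℕ∞`), `2π`-periodic, `μ ∈ klWindowC`.

So for the (R-I) two-leg slot: `FrameOKFn`'s symmetry and `ContDiff ℝ 4` conjuncts for the emitted pieces and the (E3a-Fn) sizes all
reduce to ANGULAR statements about the profiles (`ν_n`, its increments) — the engine's (E3g)-type data — with volume-free numerals.
Proofs only (no definitions); nothing is asserted about the model.
-/

noncomputable section

namespace Summit.HubbardSuperconductivity.HubbardSuperconductivity.Theorems.KLRegimeSplit

set_option linter.dupNamespace false -- summit = problem name (single-conjunct summit), D-0017

open Real Finset Filter Literature.MathematicalPhysics.QuantumLattice Literature.MathematicalPhysics.QuantumLattice.FermiRG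
open scoped Topology

/-! ## §1 The polar angle of a reflected / swapped momentum, read through a symmetric periodic profile -/

/-- **The polar angle is determined modulo `2π` by `r cos φ = k₀`, `r sin φ = k₁`.** -/
theorem polarAngle_eq_add_int_mul {k : Fin 2 → ℝ} (hk : k ≠ 0) {φ : ℝ} (hc : ‖momToComplex k‖ * Real.cos φ = k 0)
    (hs : ‖momToComplex k‖ * Real.sin φ = k 1) : ∃ z : ℤ, polarAngle k = φ + z * (2 * Real.pi) := by
  have hr : 0 < ‖momToComplex k‖ := norm_pos_iff.mpr fun h => hk ((momToComplex_eq_zero_iff k).1 h)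
  have hc0 := norm_mul_cos_polarAngle k
  have hs0 := norm_mul_sin_polarAngle k
  have hcos : Real.cos (polarAngle k) = Real.cos φ := mul_left_cancel₀ hr.ne' (hc0.trans hc.symm)
  have hsin : Real.sin (polarAngle k) = Real.sin φ := mul_left_cancel₀ hr.ne' (hs0.trans hs.symm)
  have hexp : Complex.exp ((polarAngle k : ℂ) * Complex.I) = Complex.exp ((φ : ℂ) * Complex.I) := by
    rw [Complex.exp_mul_I, Complex.exp_mul_I, ← Complex.ofReal_cos, ← Complex.ofReal_sin, ← Complex.ofReal_cos,
      ← Complex.ofReal_sin, hcos, hsin]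
  obtain ⟨n, hn⟩ := Complex.exp_eq_exp_iff_exists_int.mp hexp
  refine ⟨n, ?_⟩
  have := congrArg Complex.im hn
  simp at this
  linarith

/-- The reflected momentum `(k₀, −k₁)` has the same norm. -/
theorem norm_momToComplex_reflect (k : Fin 2 → ℝ) : ‖momToComplex ![k 0, -k 1]‖ = ‖momToComplex k‖ := by
  have h1 : ‖momToComplex ![k 0, -k 1]‖ ^ 2 = ‖momToComplex k‖ ^ 2 := by
    rw [Complex.sq_norm, Complex.sq_norm, Complex.normSq_apply, Complex.normSq_apply, momToComplex_re, momToComplex_im,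
      momToComplex_re, momToComplex_im]
    simp only [Matrix.cons_val_zero, Matrix.cons_val_one]; ring
  exact (sq_eq_sq₀ (norm_nonneg _) (norm_nonneg _)).1 h1

/-- The swapped momentum `(k₁, k₀)` has the same norm. -/
theorem norm_momToComplex_swap (k : Fin 2 → ℝ) : ‖momToComplex ![k 1, k 0]‖ = ‖momToComplex k‖ := by
  have h1 : ‖momToComplex ![k 1, k 0]‖ ^ 2 = ‖momToComplex k‖ ^ 2 := by
    rw [Complex.sq_norm, Complex.sq_norm, Complex.normSq_apply, Complex.normSq_apply, momToComplex_re, momToComplex_im,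
      momToComplex_re, momToComplex_im]
    simp only [Matrix.cons_val_zero, Matrix.cons_val_one]; ring
  exact (sq_eq_sq₀ (norm_nonneg _) (norm_nonneg _)).1 h1

/-- **An even `2π`-periodic profile does not see the reflection `(k₀,k₁) ↦ (k₀,−k₁)`.** -/
theorem apply_polarAngle_reflect {f : ℝ → ℝ} (hper : Function.Periodic f (2 * Real.pi)) (heven : ∀ θ, f (-θ) = f θ)
    {k : Fin 2 → ℝ} (hk : k ≠ 0) : f (polarAngle ![k 0, -k 1]) = f (polarAngle k) := by
  have hk' : (![k 0, -k 1] : Fin 2 → ℝ) ≠ 0 := by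
    intro h
    apply hk
    funext i
    have h0 := congrFun h 0
    have h1 := congrFun h 1
    simp at h0 h1
    fin_cases i <;> simp [h0, h1]
  obtain ⟨z, hz⟩ := polarAngle_eq_add_int_mul hk' (φ := -polarAngle k)
    (by rw [norm_momToComplex_reflect, Real.cos_neg, norm_mul_cos_polarAngle]; simp)
    (by rw [norm_momToComplex_reflect, Real.sin_neg, mul_neg, norm_mul_sin_polarAngle]; simp)
  rw [hz, hper.int_mul z, heven]

/-- **A profile with `f(π/2 − θ) = f(θ)`, `2π`-periodic, does not see the swap `(k₀,k₁) ↦ (k₁,k₀)`.** -/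
theorem apply_polarAngle_swap {f : ℝ → ℝ} (hper : Function.Periodic f (2 * Real.pi)) (hdiag : ∀ θ, f (Real.pi / 2 - θ) = f θ)
    {k : Fin 2 → ℝ} (hk : k ≠ 0) : f (polarAngle ![k 1, k 0]) = f (polarAngle k) := by
  have hk' : (![k 1, k 0] : Fin 2 → ℝ) ≠ 0 := by
    intro h
    apply hk
    funext i
    have h0 := congrFun h 0
    have h1 := congrFun h 1
    simp at h0 h1
    fin_cases i <;> simp [h0, h1]
  obtain ⟨z, hz⟩ := polarAngle_eq_add_int_mul hk' (φ := Real.pi / 2 - polarAngle k)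
    (by rw [norm_momToComplex_swap, Real.cos_pi_div_two_sub, norm_mul_sin_polarAngle]; simp)
    (by rw [norm_momToComplex_swap, Real.sin_pi_div_two_sub, norm_mul_cos_polarAngle]; simp)
  rw [hz, hper.int_mul z, hdiag]

/-! ## §2 Centring under the symmetries -/

/-- Centring commutes with negation off the cell boundary: `toIocMod (−π) (−x) = −toIocMod (−π) x` if `toIocMod (−π) x ≠ π`. -/
theorem toIocMod_neg_eq_neg_of_ne_pi {x : ℝ} (hx : toIocMod Real.two_pi_pos (-Real.pi) x ≠ Real.pi) :
    toIocMod Real.two_pi_pos (-Real.pi) (-x) = -toIocMod Real.two_pi_pos (-Real.pi) x := by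
  set c := toIocMod Real.two_pi_pos (-Real.pi) x with hc
  have hmem : c ∈ Set.Ioc (-Real.pi) (-Real.pi + 2 * Real.pi) := toIocMod_mem_Ioc _ _ _
  obtain ⟨z, hz⟩ : ∃ z : ℤ, x = c + z • (2 * Real.pi) :=
    ⟨toIocDiv Real.two_pi_pos (-Real.pi) x, by rw [hc, toIocMod]; abel⟩
  rw [toIocMod_eq_iff]
  refine ⟨⟨?_, ?_⟩, -z, ?_⟩
  · have : c < Real.pi := lt_of_le_of_ne (by linarith [hmem.2]) hx
    linarith
  · linarith [hmem.1]
  · rw [hz]; simp [zsmul_eq_mul]; ring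

/-- On the cell boundary centring of `−x` gives `π` again. -/
theorem toIocMod_neg_eq_of_eq_pi {x : ℝ} (hx : toIocMod Real.two_pi_pos (-Real.pi) x = Real.pi) :
    toIocMod Real.two_pi_pos (-Real.pi) (-x) = Real.pi := by
  obtain ⟨z, hz⟩ : ∃ z : ℤ, x = Real.pi + z • (2 * Real.pi) := by
    refine ⟨toIocDiv Real.two_pi_pos (-Real.pi) x, ?_⟩
    have h := toIocMod_add_toIocDiv_zsmul Real.two_pi_pos (-Real.pi) x
    rw [hx] at h
    exact h.symm
  rw [toIocMod_eq_iff]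
  refine ⟨⟨by linarith [Real.pi_pos], by linarith⟩, -z - 1, ?_⟩
  rw [hz]; simp [zsmul_eq_mul]; ring

/-- Centring commutes with the swap. -/
theorem centredRep_swap (p : Fin 2 → ℝ) : centredRep ![p 1, p 0] = ![centredRep p 1, centredRep p 0] := by
  funext i; fin_cases i <;> rfl

/-- Centring is `2π`-periodic coordinatewise. -/
theorem centredRep_add_int_mul (p : Fin 2 → ℝ) (z : Fin 2 → ℤ) :
    centredRep (fun i => p i + z i * (2 * Real.pi)) = centredRep p := by
  funext i
  simp only [centredRep]
  rw [← zsmul_eq_mul, toIocMod_add_zsmul]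

/-- The free band does not see centring, reflection, swap, or `2π`-translations. -/
theorem freeBandFn_symm (p : Fin 2 → ℝ) (z : Fin 2 → ℤ) :
    freeBandFn (fun i => p i + z i * (2 * Real.pi)) = freeBandFn p ∧ freeBandFn ![p 0, -p 1] = freeBandFn p ∧
      freeBandFn ![p 1, p 0] = freeBandFn p ∧ freeBandFn (centredRep p) = freeBandFn p := by
  refine ⟨?_, ?_, ?_, ?_⟩
  · have h : ∀ i, Real.cos (p i + z i * (2 * Real.pi)) = Real.cos (p i) := fun i => Real.cos_add_int_mul_two_pi _ _
    simp only [freeBandFn, h]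
  · simp [freeBandFn, Real.cos_neg]
  · simp [freeBandFn]; ring
  · exact sqDispersion_centred p

/-! ## §3 `klFrameExtFn μ f` is a symmetric frame -/

/-- **`klFrameExtFn μ f` is a symmetric frame** (`2π`-periodic, axis-reflection and swap invariant) as soon as the profile `f` is
`2π`-periodic, even and invariant under `θ ↦ π/2 − θ` (the `D₄`-symmetries of the local part `ν_n(K)` of a symmetric frame), for every
`μ ≥ −39/10` (so that the cutoff kills the centre of the zone, where the angle is undefined). -/
theorem isSymmetricFrame_klFrameExtFn {f : ℝ → ℝ} (hper : Function.Periodic f (2 * Real.pi)) (heven : ∀ θ, f (-θ) = f θ)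
    (hdiag : ∀ θ, f (Real.pi / 2 - θ) = f θ) {μ : ℝ} (hμ : -(39 / 10) ≤ μ) : IsSymmetricFrame (klFrameExtFn μ f) := by
  -- at the centre of the zone the cutoff vanishes
  have hcentre : ∀ p : Fin 2 → ℝ, centredRep p = 0 → klFlatCutoffFn μ p = 0 := by
    intro p hp
    apply klFlatCutoffFn_eq_zero_of_le_abs
    have h4 : freeBandFn p = -4 := by
      rw [← (freeBandFn_symm p 0).2.2.2, hp]; simp [freeBandFn]; norm_num
    rw [h4, klFlatR]
    rw [abs_of_nonpos (by linarith)]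
    linarith
  refine ⟨fun p z => ?_, fun p => ?_, fun p => ?_⟩
  · -- periodicity
    simp only [klFrameExtFn, klFlatCutoffFn, (freeBandFn_symm p z).1, centredRep_add_int_mul]
  · -- reflection `(p₀, p₁) ↦ (p₀, −p₁)`
    simp only [klFrameExtFn, klFlatCutoffFn, (freeBandFn_symm p 0).2.1]
    by_cases h0 : centredRep p = 0
    · have hc := hcentre p h0
      simp only [klFlatCutoffFn] at hc
      rw [hc]
      ring
    · by_cases hpi : toIocMod Real.two_pi_pos (-Real.pi) (p 1) = Real.pi
      · -- on the cell boundary the centred reflected point coincides with the centred point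
        have : centredRep ![p 0, -p 1] = centredRep p := by
          funext i; fin_cases i
          · rfl
          · show toIocMod Real.two_pi_pos (-Real.pi) (-p 1) = toIocMod Real.two_pi_pos (-Real.pi) (p 1)
            rw [toIocMod_neg_eq_of_eq_pi hpi, hpi]
        rw [this]
      · have : centredRep ![p 0, -p 1] = ![centredRep p 0, -centredRep p 1] := by
          funext i; fin_cases i
          · rfl
          · exact toIocMod_neg_eq_neg_of_ne_pi hpi
        rw [this, apply_polarAngle_reflect hper heven h0]
  · -- swap
    simp only [klFrameExtFn, klFlatCutoffFn, (freeBandFn_symm p 0).2.2.1, centredRep_swap]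
    by_cases h0 : centredRep p = 0
    · have hc := hcentre p h0
      simp only [klFlatCutoffFn] at hc
      rw [hc]
      ring
    · rw [apply_polarAngle_swap hper hdiag h0]

/-! ## §4 `onM (klFrameExtFn μ f)`: smoothness on the window and the explicit derivative bounds -/

/-- The de-interpolated G-extension read on `Momentum`, unfolded (the lambda of `…SplitFrameExtFnBounds`). -/
theorem onM_klFrameExtFn_eq (μ : ℝ) (f : ℝ → ℝ) :
    onM (klFrameExtFn μ f) = fun q : Momentum =>
      klAngularMean f + (1 - salmhoferCutoff ((sqDispersion (WithLp.ofLp q) - μ) ^ 2 / (4 * klFlatR ^ 2))) *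
        (f (polarAngle (fun i => toIocMod Real.two_pi_pos (-Real.pi) (WithLp.ofLp q i))) - klAngularMean f) := by
  funext q
  simp only [onM, klFrameExtFn, klFlatCutoffFn, freeBandFn, sqDispersion]
  rfl

section Smooth

variable {f : ℝ → ℝ} {N : WithTop ℕ∞}

/-- **EXPLICIT DERIVATIVE BOUNDS OF `klFrameExtFn`, EVERY ORDER, EVERY MOMENTUM, VOLUME-FREE**: for `μ ∈ klWindowC`, `f` `C^N` and
`2π`-periodic with `‖Dⁱ(f − mean f)‖ ≤ G` (`i ≤ n`) and `‖Dˡχ₂‖ ≤ X` (`l ≤ n`):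
`‖Dⁿ (onM (klFrameExtFn μ f)) q‖ ≤ [n=0]·|mean f| + (n!)²·(2·n!·X·200ⁿ)·G·(4 + max 1 (5(n−1)!/8))ⁿ`. -/
theorem norm_iteratedFDeriv_onM_klFrameExtFn_le (hf : ContDiff ℝ N f) (hper : Function.Periodic f (2 * Real.pi)) {n : ℕ}
    (hn : (n : WithTop ℕ∞) ≤ N) {G X μ : ℝ} (hμ : μ ∈ klWindowC)
    (hG : ∀ i ≤ n, ∀ t : ℝ, ‖iteratedFDeriv ℝ i (fun t => f t - klAngularMean f) t‖ ≤ G)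
    (hX : ∀ l ≤ n, ∀ x : ℝ, ‖iteratedFDeriv ℝ l salmhoferCutoff x‖ ≤ X) (q : Momentum) :
    ‖iteratedFDeriv ℝ n (onM (klFrameExtFn μ f)) q‖ ≤
      (if n = 0 then |klAngularMean f| else 0) +
        (n.factorial : ℝ) ^ 2 * (2 * n.factorial * X * 200 ^ n) * G * (4 + max 1 (((n - 1).factorial : ℝ) / (8 / 5))) ^ n := by
  rw [onM_klFrameExtFn_eq]
  exact norm_iteratedFDeriv_frameExtFn_le hf hper hn hμ hG hX q

/-- **`klFrameExtFn μ f` is as smooth as `f` on `Momentum`** for `μ ∈ klWindowC`: off the tube it is locally the constant `mean f`, on the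
tube centring is locally a translation and the angular factor is a smooth periodic function of the polar angle off the origin. -/
theorem contDiff_onM_klFrameExtFn {N : ℕ∞} (hf : ContDiff ℝ N f) (hper : Function.Periodic f (2 * Real.pi)) {μ : ℝ}
    (hμ : μ ∈ klWindowC) : ContDiff ℝ N (onM (klFrameExtFn μ f)) := by
  have hμ' := hμ
  simp only [klWindowC, Set.mem_Icc] at hμ'
  set m : ℝ := klAngularMean f with hm
  set g : ℝ → ℝ := fun t => f t - m with hg
  have hgc : ContDiff ℝ N g := hf.sub contDiff_const
  have hgp : Function.Periodic g (2 * Real.pi) := fun t => by simp [hg, hper t]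
  have hfun : onM (klFrameExtFn μ f) = fun q : Momentum =>
      m + (1 - salmhoferCutoff (100 * (sqDispersion (WithLp.ofLp q) - μ) ^ 2)) *
        g (polarAngle (fun i => toIocMod Real.two_pi_pos (-Real.pi) (WithLp.ofLp q i))) := by
    rw [onM_klFrameExtFn_eq]; funext q'; rw [div_four_klFlatR_sq]
  rw [hfun]
  refine contDiff_iff_contDiffAt.mpr fun q => ?_
  by_cases hW : 1 / 10 < |sqDispersion (WithLp.ofLp q) - μ|
  · -- off the tube: locally constant
    have hopen : IsOpen {q' : Momentum | 1 / 10 < |sqDispersion (WithLp.ofLp q') - μ|} :=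
      isOpen_lt continuous_const ((contDiff_sqDispersion_ofLp (N := 0)).continuous.sub continuous_const).abs
    have hev : (fun q : Momentum => m + (1 - salmhoferCutoff (100 * (sqDispersion (WithLp.ofLp q) - μ) ^ 2)) *
          g (polarAngle (fun i => toIocMod Real.two_pi_pos (-Real.pi) (WithLp.ofLp q i)))) =ᶠ[𝓝 q]
        fun _ => m := by
      filter_upwards [hopen.mem_nhds hW] with q' hq'
      rw [flatProfile_eq_zero_of_le hq'.le, zero_mul, add_zero]
    exact (contDiffAt_const (c := m)).congr_of_eventuallyEq hev
  · -- on the tube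
    have hεle : sqDispersion (WithLp.ofLp q) - μ ≤ 1 / 10 := (abs_le.mp (not_lt.mp hW)).2
    have hεge : -(1 / 10) ≤ sqDispersion (WithLp.ofLp q) - μ := (abs_le.mp (not_lt.mp hW)).1
    have hεneg : sqDispersion (WithLp.ofLp q) < 0 := by linarith
    have hne : ∀ i : Fin 2, toIocMod Real.two_pi_pos (-Real.pi) (WithLp.ofLp q i) ≠ -Real.pi + 2 * Real.pi := by
      intro i h
      have h' : toIocMod Real.two_pi_pos (-Real.pi) (WithLp.ofLp q i) = Real.pi := by rw [h]; ring
      have hnn := sqDispersion_nonneg_of_coord_eq_pi (p := fun j => toIocMod Real.two_pi_pos (-Real.pi) (WithLp.ofLp q j))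
        (i := i) h'
      rw [sqDispersion_centred] at hnn
      linarith
    set z : Fin 2 → ℤ := fun i => toIocDiv Real.two_pi_pos (-Real.pi) (WithLp.ofLp q i) with hz
    set c : Momentum := WithLp.toLp 2 fun i => (z i : ℝ) * (2 * Real.pi) with hc
    have hev1 : ∀ i : Fin 2, ∀ᶠ q' : Momentum in 𝓝 q,
        toIocMod Real.two_pi_pos (-Real.pi) (WithLp.ofLp q' i) = WithLp.ofLp q' i - (z i : ℝ) * (2 * Real.pi) := by
      intro i
      have hcont : ContinuousAt (fun q' : Momentum => WithLp.ofLp q' i) q :=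
        ((continuous_apply i).comp (PiLp.continuous_ofLp 2 _)).continuousAt
      have h2 := hcont.eventually (eventually_toIocMod_eq_sub Real.two_pi_pos (-Real.pi) (hne i))
      filter_upwards [h2] with q' hq'
      rw [hq', zsmul_eq_mul]
    have hevall : ∀ᶠ q' : Momentum in 𝓝 q, ∀ i : Fin 2,
        toIocMod Real.two_pi_pos (-Real.pi) (WithLp.ofLp q' i) = WithLp.ofLp q' i - (z i : ℝ) * (2 * Real.pi) :=
      Filter.eventually_all.mpr hev1
    set S₀ : Momentum → ℝ := fun q' => (1 - salmhoferCutoff (100 * (sqDispersion (WithLp.ofLp q') - μ) ^ 2)) *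
      g (polarAngle (WithLp.ofLp q')) with hS₀def
    have hev : (fun q : Momentum => m + (1 - salmhoferCutoff (100 * (sqDispersion (WithLp.ofLp q) - μ) ^ 2)) *
          g (polarAngle (fun i => toIocMod Real.two_pi_pos (-Real.pi) (WithLp.ofLp q i)))) =ᶠ[𝓝 q]
        fun q' => m + S₀ (q' - c) := by
      filter_upwards [hevall] with q' hq'
      have hcen : (fun i => toIocMod Real.two_pi_pos (-Real.pi) (WithLp.ofLp q' i)) = WithLp.ofLp (q' - c) := by
        funext i; rw [hq' i, WithLp.ofLp_sub, Pi.sub_apply, hc, WithLp.ofLp_toLp]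
      rw [hS₀def]
      simp only
      rw [hcen, WithLp.ofLp_sub, hc, WithLp.ofLp_toLp]
      congr 2
      rw [show (WithLp.ofLp q' - fun i => (z i : ℝ) * (2 * Real.pi)) = fun i => WithLp.ofLp q' i - (z i : ℝ) * (2 * Real.pi)
        from rfl, sqDispersion_sub_zsmul_two_pi]
    have hq0 : q - c ≠ 0 := by
      intro h0
      have hq' := hevall.self_of_nhds
      have hzero : (fun i => toIocMod Real.two_pi_pos (-Real.pi) (WithLp.ofLp q i)) = 0 := by
        funext i; rw [hq' i]
        have := congrArg (fun v : Momentum => WithLp.ofLp v i) h0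
        simpa [hc] using this
      have h4 : sqDispersion (fun i => toIocMod Real.two_pi_pos (-Real.pi) (WithLp.ofLp q i)) = -4 := by
        rw [hzero]; simp [sqDispersion]; norm_num
      rw [sqDispersion_centred] at h4
      linarith
    have hS₀c : ContDiffAt ℝ N S₀ (q - c) := by
      have h1 : ContDiffAt ℝ N (fun q' : Momentum => 1 - salmhoferCutoff (100 * (sqDispersion (WithLp.ofLp q') - μ) ^ 2))
          (q - c) := by
        have hψ : ContDiff ℝ N (fun u : ℝ => 1 - salmhoferCutoff (100 * (u - μ) ^ 2)) := contDiff_flatProfile μ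
        exact (hψ.comp contDiff_sqDispersion_ofLp).contDiffAt
      exact h1.mul (contDiffAt_comp_polarAngle_ofLp hgc hgp hq0)
    have hshift : ContDiffAt ℝ N (fun q' : Momentum => S₀ (q' - c)) q := by
      have : ContDiffAt ℝ N S₀ ((fun q' : Momentum => q' - c) q) := hS₀c
      exact this.comp q (contDiff_id.sub contDiff_const).contDiffAt
    exact (contDiffAt_const.add hshift).congr_of_eventuallyEq hev

end Smooth

end Summit.HubbardSuperconductivity.HubbardSuperconductivity.Theorems.KLRegimeSplit

end
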